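import Mathlib
import HarnessLib
import Summits.HubbardSuperconductivity.HubbardSuperconductivity.Theorems.KLProgrammeKLRegimeEngineTowerLipschitz

/-!
# Route `KLProgramme` — crux K3 ENGINE (stmt-HubbardSuperconductivity-20437 `KLRegimeEngineV17F2`), stub (e) proof-input «(e)-D-ROWS», F-D7b (generic half): THE IMAGE
# OF THE LIPSCHITZ STEP ON A BUDGETED FOUR-PIECE PROFILE — every degree index `p ≥ 1`, linear in the budget
# (seat hubbard-kl-k3c4-p1 g25, VL lane; supplier of the `hstep` hypothesis of `…EngineTowerLipschitzGeomBudget.towerDiff_le_of_geomBudget`; DROWS-SCOPE-g25 §13.6)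

The two-volume LINK (`…TwoVolumeLipStepLinkUniform.klLipBornDiffSup_le_kitStep_of_bounds`) bounds the born difference of a block by the Lipschitz kit step
`towerFO D σ ν p + Σ_{n≤N} eΦ^{n−1}ψ^p towerSLip D τ ν μ n p + Ct·tail_N + src` of its difference array `ν` against the one-volume majorant `μ`, for every truncation `N`.
`towerDiff_le_of_geomBudget` wants the IMAGE of that step on the profile `ν ≤ R·Y`: a bound `db ≤ R·C_p + src` with a k-uniform `C_p` of the right size in the
small parameter `λ` (`C_1, C_2 = O(λ)`, `C_3 = O(λ²)`, `C_p = O(λ^{p−1}Q^p)` for `p ≥ 4`).  This file computes it, by `towerLipStep_le_of_chernoff` (`N → ∞`, the tail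
vanishes) with T3's weight `w = (2τQ′λ)⁻¹` in the degrees `p ≥ 3` (T3-Lip₄'s own step estimate, extracted before its closing inequality) and with `w = 1` in the low
degrees `p ≥ 1` (the graded sum is then `O(λ²)`: `Σ_δ τ^δ μ δ = towerV D (τ/e) μ` is `O(λ)` by `towerV_le_fourPiece`):

* `towerV_div_exp_eq` — `Σ_{δ∈[1,D]} τ^δ μ δ·1^{δ−1} = towerV D (τ/e) μ`;
* **`lipStepImage_le_of_three_le`** — `p ≥ 3`: `db ≤ R·(A′λ^{p−1}(4Q′)^p·X₁ + eψ^p(2τQ′λ)^{p−1}(τY)·Z(Φ(τY))) + src`, `X₁ = 4σλQ′/(1−4σλQ′)`, `Y = ι₁λ + ι₂/(2Q′) + ι₃/(4Q′²) + A′Q′/4`,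
  `Z(y) = (2y−y²)/(1−y)²`;
* `lipStepImage_le_of_three_le'`, `lipStepImage_le_low'` — the same two with SEPARATE profile constants `κ₁ κ₂ κ₃ Aν` for `ν/R` (§2; g25 append);
* **`lipStepImage_le_low`** — `p ≥ 1`: `db ≤ R·(A″λ^{p−1}(4Q′)^p·X₁ + eψ^p·V₁·Z(Φ·V₁)) + src`, `A″ = A′ + ι₁λ/Q′ + ι₂/Q′² + ι₃/Q′³` (one-piece envelope of the four-piece
  profile), `V₁ = τ(ι₁λ) + τ²(ι₂λ) + τ³(ι₃λ²) + A′(τQ′)(τλQ′)³/(1−τλQ′)` (`= towerV_le_fourPiece` at `τ/e`, `O(λ)`), under the guards `Φ·V₁ < 1`, `Φ·V_b < 1`.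

Pure real analysis; nothing about the model is asserted; nothing asserts the (D) rows, stub (e), VL, K3 or superconductivity.
References: BGM 2006 §2.8 (2.93)–(2.98), §3 (3.2)–(3.8) [cite: BenfattoGiulianiMastropietro2006]; Gawȩdzki–Kupiainen 1985 §3.
-/

noncomputable section

namespace Summit.HubbardSuperconductivity.HubbardSuperconductivity.Theorems.EngineV8

set_option linter.dupNamespace false -- summit = problem name (single-conjunct summit), D-0017

open Real Finset

/-- `Σ_{δ∈[1,D]} τ^δ μ δ·1^{δ−1} = towerV D (τ/e) μ` (`(e·(τ/e))^δ = τ^δ`). -/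
theorem towerV_div_exp_eq (D : ℕ) (τ : ℝ) (μ : ℕ → ℝ) :
    ∑ δ ∈ Icc 1 D, τ ^ δ * μ δ * (1 : ℝ) ^ (δ - 1) = towerV D (τ / exp 1) μ := by
  unfold towerV
  refine sum_congr rfl fun δ _ => ?_
  rw [one_pow, mul_one, mul_div_cancel₀ _ (exp_pos 1).ne']

/-- **The image of the Lipschitz step in the degrees `p ≥ 3`** (T3-Lip₄'s step estimate, budget `R` carried linearly).  Difference array `ν` with the budgeted
four-piece profile (`ν 1 ≤ R·ι₁λ`, `ν 2 ≤ R·ι₂λ`, `ν 3 ≤ R·ι₃λ²`, `ν m ≤ R·A′λ^{m−1}Q′^m`), majorant `μ` with the four-piece profile, the kit step for every `N ≥ 2`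
under the guard, and the soft kit conditions `4σλQ′ < 1`, `2λτQ′ ≤ 1`, `eτλQ′ < 1`, `Φ·τY < 1`, `Φ·V_b < 1`. [cite: BenfattoGiulianiMastropietro2006, §2.8 (2.93)-(2.98)] -/
theorem lipStepImage_le_of_three_le {D p : ℕ} {ν μ : ℕ → ℝ} {db src σ Φ ψ τ Ct lam Q' A' ι₁ ι₂ ι₃ R : ℝ}
    (hp : 3 ≤ p) (hσ : 0 ≤ σ) (hΦ : 0 ≤ Φ) (hψ : 0 ≤ ψ) (hτ : 0 < τ) (hCt : 0 ≤ Ct) (hlam : 0 < lam) (hQ' : 0 < Q') (hA' : 0 ≤ A') (hR : 0 ≤ R)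
    (hν0 : ∀ m, 0 ≤ ν m) (hμ0 : ∀ m, 0 ≤ μ m)
    (hι₁ : μ 1 ≤ ι₁ * lam) (hι₂ : μ 2 ≤ ι₂ * lam) (hι₃ : μ 3 ≤ ι₃ * lam ^ 2)
    (hprofb : ∀ m, 4 ≤ m → m ≤ D → μ m ≤ A' * lam ^ (m - 1) * Q' ^ m)
    (hν₁ : ν 1 ≤ R * (ι₁ * lam)) (hν₂ : ν 2 ≤ R * (ι₂ * lam)) (hν₃ : ν 3 ≤ R * (ι₃ * lam ^ 2))
    (hνprof : ∀ m, 4 ≤ m → m ≤ D → ν m ≤ R * (A' * lam ^ (m - 1) * Q' ^ m))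
    (hx₁ : 4 * σ * lam * Q' < 1) (hx₂ : 2 * lam * τ * Q' ≤ 1) (hx₃ : exp 1 * τ * lam * Q' < 1)
    (hy : Φ * (τ * (ι₁ * lam + ι₂ / (2 * Q') + ι₃ / (4 * Q' ^ 2) + A' * Q' / 4)) < 1)
    (hθ : Φ * (exp 1 * τ * (ι₁ * lam) + (exp 1 * τ) ^ 2 * (ι₂ * lam) + (exp 1 * τ) ^ 3 * (ι₃ * lam ^ 2) +
      A' * (exp 1 * τ * Q') * ((exp 1 * τ * lam * Q') ^ 3 / (1 - exp 1 * τ * lam * Q'))) < 1)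
    (hstep : ∀ N : ℕ, 2 ≤ N → Φ * towerV D τ μ < 1 →
      db ≤ towerFO D σ ν p + ∑ n ∈ Icc 2 N, exp 1 * Φ ^ (n - 1) * ψ ^ p * towerSLip D τ ν μ n p +
        Ct * (ψ ^ p * exp 1 * towerV D τ μ * (Φ * towerV D τ μ) ^ N / (1 - Φ * towerV D τ μ)) + src) :
    db ≤ R * (A' * lam ^ (p - 1) * (4 * Q') ^ p * (4 * σ * lam * Q' / (1 - 4 * σ * lam * Q')) +
        exp 1 * ψ ^ p * (2 * τ * Q' * lam) ^ (p - 1) * (τ * (ι₁ * lam + ι₂ / (2 * Q') + ι₃ / (4 * Q' ^ 2) + A' * Q' / 4)) *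
          ((2 * (Φ * (τ * (ι₁ * lam + ι₂ / (2 * Q') + ι₃ / (4 * Q' ^ 2) + A' * Q' / 4))) -
              (Φ * (τ * (ι₁ * lam + ι₂ / (2 * Q') + ι₃ / (4 * Q' ^ 2) + A' * Q' / 4))) ^ 2) /
            (1 - Φ * (τ * (ι₁ * lam + ι₂ / (2 * Q') + ι₃ / (4 * Q' ^ 2) + A' * Q' / 4))) ^ 2)) + src := by
  have hw : 1 ≤ (2 * τ * Q' * lam)⁻¹ := (one_le_inv₀ (by positivity)).2 (by linarith)
  set Y := ι₁ * lam + ι₂ / (2 * Q') + ι₃ / (4 * Q' ^ 2) + A' * Q' / 4 with hY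
  have hprofd' : ∀ m, 4 ≤ m → m ≤ D → ν m ≤ (R * A') * lam ^ (m - 1) * Q' ^ m := fun m hm hmD =>
    (hνprof m hm hmD).trans_eq (by ring)
  have hdμ3' : ν 3 ≤ (R * ι₃) * lam ^ 2 := hν₃.trans_eq (by ring)
  have hdι₁' : ν 1 ≤ (R * ι₁) * lam := hν₁.trans_eq (by ring)
  have hdι₂' : ν 2 ≤ (R * ι₂) * lam := hν₂.trans_eq (by ring)
  have hGν := sum_fourPiece_le (D := D) (ι₁ := R * ι₁) (ι₂ := R * ι₂) (ι₃ := R * ι₃) (A' := R * A') hτ hlam hQ'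
    (mul_nonneg hR hA') hν0 hdι₁' hdι₂' hdμ3' hprofd'
  have hGνeq : τ * (R * ι₁ * lam + R * ι₂ / (2 * Q') + R * ι₃ / (4 * Q' ^ 2) + R * A' * Q' / 4) = R * (τ * Y) := by
    rw [hY]; ring
  rw [hGνeq] at hGν
  have hG := sum_fourPiece_le (D := D) hτ hlam hQ' hA' hμ0 hι₁ hι₂ hι₃ hprofb
  have hVb := towerV_le_fourPiece hτ.le hlam.le hQ'.le hA' hμ0 hι₁ hι₂ hι₃ hprofb hx₃
  have hFO := towerFO_le_of_four_le hσ (mul_nonneg hR hA') hlam.le hQ'.le hν0 hprofd' hx₁ hp (D := D)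
  have hT2 := towerLipStep_le_of_chernoff (D := D) hΦ hψ hτ.le hν0 hμ0 hw hCt hFO hGν hG hVb hy hθ hstep
  refine hT2.trans (le_of_eq ?_)
  have hinv : (((2 * τ * Q' * lam)⁻¹) ^ (p - 1))⁻¹ = (2 * τ * Q' * lam) ^ (p - 1) := by rw [inv_pow, inv_inv]
  rw [hinv]
  ring

/-- **The image of the Lipschitz step in the LOW degrees `p ≥ 1`** (weight `w = 1`: the graded sum carries the two powers of `λ` of its shortest products).  Same data as
`lipStepImage_le_of_three_le` with `ι₁, ι₂, ι₃ ≥ 0`; the first order through the one-piece envelope `A″ = A′ + ι₁λ/Q′ + ι₂/Q′² + ι₃/Q′³` of the four-piece profile;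
guards `Φ·V₁ < 1` (`V₁ = τ(ι₁λ) + τ²(ι₂λ) + τ³(ι₃λ²) + A′(τQ′)(τλQ′)³/(1−τλQ′)`) and `Φ·V_b < 1`. [cite: BenfattoGiulianiMastropietro2006, §2.8 (2.93)-(2.98)] -/
theorem lipStepImage_le_low {D p : ℕ} {ν μ : ℕ → ℝ} {db src σ Φ ψ τ Ct lam Q' A' ι₁ ι₂ ι₃ R : ℝ}
    (hp : 1 ≤ p) (hσ : 0 ≤ σ) (hΦ : 0 ≤ Φ) (hψ : 0 ≤ ψ) (hτ : 0 < τ) (hCt : 0 ≤ Ct) (hlam : 0 < lam) (hQ' : 0 < Q') (hA' : 0 ≤ A') (hR : 0 ≤ R)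
    (hι₁0 : 0 ≤ ι₁) (hι₂0 : 0 ≤ ι₂) (hι₃0 : 0 ≤ ι₃)
    (hν0 : ∀ m, 0 ≤ ν m) (hμ0 : ∀ m, 0 ≤ μ m)
    (hι₁ : μ 1 ≤ ι₁ * lam) (hι₂ : μ 2 ≤ ι₂ * lam) (hι₃ : μ 3 ≤ ι₃ * lam ^ 2)
    (hprofb : ∀ m, 4 ≤ m → m ≤ D → μ m ≤ A' * lam ^ (m - 1) * Q' ^ m)
    (hν₁ : ν 1 ≤ R * (ι₁ * lam)) (hν₂ : ν 2 ≤ R * (ι₂ * lam)) (hν₃ : ν 3 ≤ R * (ι₃ * lam ^ 2))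
    (hνprof : ∀ m, 4 ≤ m → m ≤ D → ν m ≤ R * (A' * lam ^ (m - 1) * Q' ^ m))
    (hx₁ : 4 * σ * lam * Q' < 1) (hxτ : τ * lam * Q' < 1) (hx₃ : exp 1 * τ * lam * Q' < 1)
    (hy₁ : Φ * (τ * (ι₁ * lam) + τ ^ 2 * (ι₂ * lam) + τ ^ 3 * (ι₃ * lam ^ 2) + A' * (τ * Q') * ((τ * lam * Q') ^ 3 / (1 - τ * lam * Q'))) < 1)
    (hθ : Φ * (exp 1 * τ * (ι₁ * lam) + (exp 1 * τ) ^ 2 * (ι₂ * lam) + (exp 1 * τ) ^ 3 * (ι₃ * lam ^ 2) +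
      A' * (exp 1 * τ * Q') * ((exp 1 * τ * lam * Q') ^ 3 / (1 - exp 1 * τ * lam * Q'))) < 1)
    (hstep : ∀ N : ℕ, 2 ≤ N → Φ * towerV D τ μ < 1 →
      db ≤ towerFO D σ ν p + ∑ n ∈ Icc 2 N, exp 1 * Φ ^ (n - 1) * ψ ^ p * towerSLip D τ ν μ n p +
        Ct * (ψ ^ p * exp 1 * towerV D τ μ * (Φ * towerV D τ μ) ^ N / (1 - Φ * towerV D τ μ)) + src) :
    db ≤ R * ((A' + ι₁ * lam / Q' + ι₂ / Q' ^ 2 + ι₃ / Q' ^ 3) * lam ^ (p - 1) * (4 * Q') ^ p * (4 * σ * lam * Q' / (1 - 4 * σ * lam * Q')) +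
        exp 1 * ψ ^ p * (τ * (ι₁ * lam) + τ ^ 2 * (ι₂ * lam) + τ ^ 3 * (ι₃ * lam ^ 2) + A' * (τ * Q') * ((τ * lam * Q') ^ 3 / (1 - τ * lam * Q'))) *
          ((2 * (Φ * (τ * (ι₁ * lam) + τ ^ 2 * (ι₂ * lam) + τ ^ 3 * (ι₃ * lam ^ 2) + A' * (τ * Q') * ((τ * lam * Q') ^ 3 / (1 - τ * lam * Q')))) -
              (Φ * (τ * (ι₁ * lam) + τ ^ 2 * (ι₂ * lam) + τ ^ 3 * (ι₃ * lam ^ 2) + A' * (τ * Q') * ((τ * lam * Q') ^ 3 / (1 - τ * lam * Q')))) ^ 2) /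
            (1 - Φ * (τ * (ι₁ * lam) + τ ^ 2 * (ι₂ * lam) + τ ^ 3 * (ι₃ * lam ^ 2) + A' * (τ * Q') * ((τ * lam * Q') ^ 3 / (1 - τ * lam * Q')))) ^ 2)) + src := by
  set A'' := A' + ι₁ * lam / Q' + ι₂ / Q' ^ 2 + ι₃ / Q' ^ 3 with hA''
  set V₁ := τ * (ι₁ * lam) + τ ^ 2 * (ι₂ * lam) + τ ^ 3 * (ι₃ * lam ^ 2) + A' * (τ * Q') * ((τ * lam * Q') ^ 3 / (1 - τ * lam * Q')) with hV₁
  have hA''0 : 0 ≤ A'' := by positivity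
  -- the one-piece envelope of the budgeted four-piece profile
  have h1d : 0 ≤ ι₁ * lam / Q' := by positivity
  have h2d : 0 ≤ ι₂ / Q' ^ 2 := by positivity
  have h3d : 0 ≤ ι₃ / Q' ^ 3 := by positivity
  have ha1 : ι₁ * lam / Q' ≤ A'' := by rw [hA'']; linarith
  have ha2 : ι₂ / Q' ^ 2 ≤ A'' := by rw [hA'']; linarith
  have ha3 : ι₃ / Q' ^ 3 ≤ A'' := by rw [hA'']; linarith
  have ha4 : A' ≤ A'' := by rw [hA'']; linarith
  have hQ0 : Q' ≠ 0 := hQ'.ne'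
  have hνone : ∀ m, 1 ≤ m → m ≤ D → ν m ≤ (R * A'') * lam ^ (m - 1) * Q' ^ m := by
    intro m hm hmD
    rcases Nat.lt_or_ge m 4 with hlt | hge
    · interval_cases m
      · calc ν 1 ≤ R * (ι₁ * lam) := hν₁
          _ = (R * Q') * (ι₁ * lam / Q') := by field_simp
          _ ≤ (R * Q') * A'' := mul_le_mul_of_nonneg_left ha1 (by positivity)
          _ = (R * A'') * lam ^ (1 - 1) * Q' ^ 1 := by simp; ring
      · calc ν 2 ≤ R * (ι₂ * lam) := hν₂
          _ = (R * lam * Q' ^ 2) * (ι₂ / Q' ^ 2) := by field_simp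
          _ ≤ (R * lam * Q' ^ 2) * A'' := mul_le_mul_of_nonneg_left ha2 (by positivity)
          _ = (R * A'') * lam ^ (2 - 1) * Q' ^ 2 := by simp; ring
      · calc ν 3 ≤ R * (ι₃ * lam ^ 2) := hν₃
          _ = (R * lam ^ 2 * Q' ^ 3) * (ι₃ / Q' ^ 3) := by field_simp
          _ ≤ (R * lam ^ 2 * Q' ^ 3) * A'' := mul_le_mul_of_nonneg_left ha3 (by positivity)
          _ = (R * A'') * lam ^ (3 - 1) * Q' ^ 3 := by simp; ring
    · calc ν m ≤ R * (A' * lam ^ (m - 1) * Q' ^ m) := hνprof m hge hmD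
        _ = (R * lam ^ (m - 1) * Q' ^ m) * A' := by ring
        _ ≤ (R * lam ^ (m - 1) * Q' ^ m) * A'' := mul_le_mul_of_nonneg_left ha4 (by positivity)
        _ = (R * A'') * lam ^ (m - 1) * Q' ^ m := by ring
  have hFO := towerFO_le hσ (mul_nonneg hR hA''0) hlam.le hQ'.le hν0 hνone hx₁ hp (D := D)
  -- the `w = 1` graded data: `Σ τ^δ ν δ ≤ R·V₁`, `Σ τ^δ μ δ ≤ V₁`
  have hτe : 0 ≤ τ / exp 1 := by positivity
  have hx₃' : exp 1 * (τ / exp 1) * lam * Q' < 1 := by rwa [mul_div_cancel₀ _ (exp_pos 1).ne']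
  have hprofd' : ∀ m, 4 ≤ m → m ≤ D → ν m ≤ (R * A') * lam ^ (m - 1) * Q' ^ m := fun m hm hmD =>
    (hνprof m hm hmD).trans_eq (by ring)
  have hdμ3' : ν 3 ≤ (R * ι₃) * lam ^ 2 := hν₃.trans_eq (by ring)
  have hdι₁' : ν 1 ≤ (R * ι₁) * lam := hν₁.trans_eq (by ring)
  have hdι₂' : ν 2 ≤ (R * ι₂) * lam := hν₂.trans_eq (by ring)
  have heτ : exp 1 * (τ / exp 1) = τ := mul_div_cancel₀ _ (exp_pos 1).ne'
  have hGν : ∑ δ ∈ Icc 1 D, τ ^ δ * ν δ * (1 : ℝ) ^ (δ - 1) ≤ R * V₁ := by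
    rw [towerV_div_exp_eq]
    refine (towerV_le_fourPiece hτe hlam.le hQ'.le (mul_nonneg hR hA') hν0 hdι₁' hdι₂' hdμ3' hprofd' hx₃').trans (le_of_eq ?_)
    rw [heτ, hV₁]; ring
  have hG : ∑ δ ∈ Icc 1 D, τ ^ δ * μ δ * (1 : ℝ) ^ (δ - 1) ≤ V₁ := by
    rw [towerV_div_exp_eq]
    refine (towerV_le_fourPiece hτe hlam.le hQ'.le hA' hμ0 hι₁ hι₂ hι₃ hprofb hx₃').trans (le_of_eq ?_)
    rw [heτ, hV₁]
  have hVb := towerV_le_fourPiece hτ.le hlam.le hQ'.le hA' hμ0 hι₁ hι₂ hι₃ hprofb hx₃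
  have hT2 := towerLipStep_le_of_chernoff (D := D) (w := 1) hΦ hψ hτ.le hν0 hμ0 le_rfl hCt hFO hGν hG hVb hy₁ hθ hstep
  refine hT2.trans (le_of_eq ?_)
  rw [one_pow, inv_one, hA'']
  ring

/-! ## §2 The same with separate profile constants for the difference array (the shapes F-D7 actually meets) -/

/-- **The image of the Lipschitz step in the degrees `p ≥ 3`, SEPARATE profile constants for the difference array** (`κ₁, κ₂, κ₃, Aν` for `ν/R`; `ι₁, ι₂, ι₃, A′`
for the majorant `μ`; `λ, Q′` shared).  Difference array `ν` with `ν 1 ≤ R·κ₁λ`, `ν 2 ≤ R·κ₂λ`, `ν 3 ≤ R·κ₃λ²`, `ν m ≤ R·Aνλ^{m−1}Q′^m`, majorant `μ` four-piece, the kit step for every `N ≥ 2`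
under the guard, and the soft kit conditions `4σλQ′ < 1`, `2λτQ′ ≤ 1`, `eτλQ′ < 1`, `Φ·τY < 1`, `Φ·V_b < 1`. [cite: BenfattoGiulianiMastropietro2006, §2.8 (2.93)-(2.98)] -/
theorem lipStepImage_le_of_three_le' {D p : ℕ} {ν μ : ℕ → ℝ} {db src σ Φ ψ τ Ct lam Q' A' ι₁ ι₂ ι₃ Aν κ₁ κ₂ κ₃ R : ℝ}
    (hp : 3 ≤ p) (hσ : 0 ≤ σ) (hΦ : 0 ≤ Φ) (hψ : 0 ≤ ψ) (hτ : 0 < τ) (hCt : 0 ≤ Ct) (hlam : 0 < lam) (hQ' : 0 < Q') (hA' : 0 ≤ A') (hAν : 0 ≤ Aν) (hR : 0 ≤ R)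
    (hν0 : ∀ m, 0 ≤ ν m) (hμ0 : ∀ m, 0 ≤ μ m)
    (hι₁ : μ 1 ≤ ι₁ * lam) (hι₂ : μ 2 ≤ ι₂ * lam) (hι₃ : μ 3 ≤ ι₃ * lam ^ 2)
    (hprofb : ∀ m, 4 ≤ m → m ≤ D → μ m ≤ A' * lam ^ (m - 1) * Q' ^ m)
    (hν₁ : ν 1 ≤ R * (κ₁ * lam)) (hν₂ : ν 2 ≤ R * (κ₂ * lam)) (hν₃ : ν 3 ≤ R * (κ₃ * lam ^ 2))
    (hνprof : ∀ m, 4 ≤ m → m ≤ D → ν m ≤ R * (Aν * lam ^ (m - 1) * Q' ^ m))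
    (hx₁ : 4 * σ * lam * Q' < 1) (hx₂ : 2 * lam * τ * Q' ≤ 1) (hx₃ : exp 1 * τ * lam * Q' < 1)
    (hy : Φ * (τ * (ι₁ * lam + ι₂ / (2 * Q') + ι₃ / (4 * Q' ^ 2) + A' * Q' / 4)) < 1)
    (hθ : Φ * (exp 1 * τ * (ι₁ * lam) + (exp 1 * τ) ^ 2 * (ι₂ * lam) + (exp 1 * τ) ^ 3 * (ι₃ * lam ^ 2) +
      A' * (exp 1 * τ * Q') * ((exp 1 * τ * lam * Q') ^ 3 / (1 - exp 1 * τ * lam * Q'))) < 1)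
    (hstep : ∀ N : ℕ, 2 ≤ N → Φ * towerV D τ μ < 1 →
      db ≤ towerFO D σ ν p + ∑ n ∈ Icc 2 N, exp 1 * Φ ^ (n - 1) * ψ ^ p * towerSLip D τ ν μ n p +
        Ct * (ψ ^ p * exp 1 * towerV D τ μ * (Φ * towerV D τ μ) ^ N / (1 - Φ * towerV D τ μ)) + src) :
    db ≤ R * (Aν * lam ^ (p - 1) * (4 * Q') ^ p * (4 * σ * lam * Q' / (1 - 4 * σ * lam * Q')) +
        exp 1 * ψ ^ p * (2 * τ * Q' * lam) ^ (p - 1) * (τ * (κ₁ * lam + κ₂ / (2 * Q') + κ₃ / (4 * Q' ^ 2) + Aν * Q' / 4)) *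
          ((2 * (Φ * (τ * (ι₁ * lam + ι₂ / (2 * Q') + ι₃ / (4 * Q' ^ 2) + A' * Q' / 4))) -
              (Φ * (τ * (ι₁ * lam + ι₂ / (2 * Q') + ι₃ / (4 * Q' ^ 2) + A' * Q' / 4))) ^ 2) /
            (1 - Φ * (τ * (ι₁ * lam + ι₂ / (2 * Q') + ι₃ / (4 * Q' ^ 2) + A' * Q' / 4))) ^ 2)) + src := by
  have hw : 1 ≤ (2 * τ * Q' * lam)⁻¹ := (one_le_inv₀ (by positivity)).2 (by linarith)
  set Y := ι₁ * lam + ι₂ / (2 * Q') + ι₃ / (4 * Q' ^ 2) + A' * Q' / 4 with hY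
  set Yν := κ₁ * lam + κ₂ / (2 * Q') + κ₃ / (4 * Q' ^ 2) + Aν * Q' / 4 with hYν
  have hprofd' : ∀ m, 4 ≤ m → m ≤ D → ν m ≤ (R * Aν) * lam ^ (m - 1) * Q' ^ m := fun m hm hmD =>
    (hνprof m hm hmD).trans_eq (by ring)
  have hdμ3' : ν 3 ≤ (R * κ₃) * lam ^ 2 := hν₃.trans_eq (by ring)
  have hdι₁' : ν 1 ≤ (R * κ₁) * lam := hν₁.trans_eq (by ring)
  have hdι₂' : ν 2 ≤ (R * κ₂) * lam := hν₂.trans_eq (by ring)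
  have hGν := sum_fourPiece_le (D := D) (ι₁ := R * κ₁) (ι₂ := R * κ₂) (ι₃ := R * κ₃) (A' := R * Aν) hτ hlam hQ'
    (mul_nonneg hR hAν) hν0 hdι₁' hdι₂' hdμ3' hprofd'
  have hGνeq : τ * (R * κ₁ * lam + R * κ₂ / (2 * Q') + R * κ₃ / (4 * Q' ^ 2) + R * Aν * Q' / 4) = R * (τ * Yν) := by
    rw [hYν]; ring
  rw [hGνeq] at hGν
  have hG := sum_fourPiece_le (D := D) hτ hlam hQ' hA' hμ0 hι₁ hι₂ hι₃ hprofb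
  have hVb := towerV_le_fourPiece hτ.le hlam.le hQ'.le hA' hμ0 hι₁ hι₂ hι₃ hprofb hx₃
  have hFO := towerFO_le_of_four_le hσ (mul_nonneg hR hAν) hlam.le hQ'.le hν0 hprofd' hx₁ hp (D := D)
  have hT2 := towerLipStep_le_of_chernoff (D := D) hΦ hψ hτ.le hν0 hμ0 hw hCt hFO hGν hG hVb hy hθ hstep
  refine hT2.trans (le_of_eq ?_)
  have hinv : (((2 * τ * Q' * lam)⁻¹) ^ (p - 1))⁻¹ = (2 * τ * Q' * lam) ^ (p - 1) := by rw [inv_pow, inv_inv]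
  rw [hinv]
  ring

/-- **The image of the Lipschitz step in the LOW degrees `p ≥ 1`, SEPARATE profile constants for the difference array** (`κ₁, κ₂, κ₃ ≥ 0`, `Aν ≥ 0`).  Same data as
`lipStepImage_le_low`; the first order through the one-piece envelope `A″ = Aν + κ₁λ/Q′ + κ₂/Q′² + κ₃/Q′³`; the graded sum `eψ^p·V₁(ν-constants)·Z(Φ·V₁(μ-constants))`;
guards `Φ·V₁ < 1` (`V₁ = τ(ι₁λ) + τ²(ι₂λ) + τ³(ι₃λ²) + A′(τQ′)(τλQ′)³/(1−τλQ′)`) and `Φ·V_b < 1`. [cite: BenfattoGiulianiMastropietro2006, §2.8 (2.93)-(2.98)] -/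
theorem lipStepImage_le_low' {D p : ℕ} {ν μ : ℕ → ℝ} {db src σ Φ ψ τ Ct lam Q' A' ι₁ ι₂ ι₃ Aν κ₁ κ₂ κ₃ R : ℝ}
    (hp : 1 ≤ p) (hσ : 0 ≤ σ) (hΦ : 0 ≤ Φ) (hψ : 0 ≤ ψ) (hτ : 0 < τ) (hCt : 0 ≤ Ct) (hlam : 0 < lam) (hQ' : 0 < Q') (hA' : 0 ≤ A') (hAν : 0 ≤ Aν) (hR : 0 ≤ R)
    (hκ₁0 : 0 ≤ κ₁) (hκ₂0 : 0 ≤ κ₂) (hκ₃0 : 0 ≤ κ₃)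
    (hν0 : ∀ m, 0 ≤ ν m) (hμ0 : ∀ m, 0 ≤ μ m)
    (hι₁ : μ 1 ≤ ι₁ * lam) (hι₂ : μ 2 ≤ ι₂ * lam) (hι₃ : μ 3 ≤ ι₃ * lam ^ 2)
    (hprofb : ∀ m, 4 ≤ m → m ≤ D → μ m ≤ A' * lam ^ (m - 1) * Q' ^ m)
    (hν₁ : ν 1 ≤ R * (κ₁ * lam)) (hν₂ : ν 2 ≤ R * (κ₂ * lam)) (hν₃ : ν 3 ≤ R * (κ₃ * lam ^ 2))
    (hνprof : ∀ m, 4 ≤ m → m ≤ D → ν m ≤ R * (Aν * lam ^ (m - 1) * Q' ^ m))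
    (hx₁ : 4 * σ * lam * Q' < 1) (hxτ : τ * lam * Q' < 1) (hx₃ : exp 1 * τ * lam * Q' < 1)
    (hy₁ : Φ * (τ * (ι₁ * lam) + τ ^ 2 * (ι₂ * lam) + τ ^ 3 * (ι₃ * lam ^ 2) + A' * (τ * Q') * ((τ * lam * Q') ^ 3 / (1 - τ * lam * Q'))) < 1)
    (hθ : Φ * (exp 1 * τ * (ι₁ * lam) + (exp 1 * τ) ^ 2 * (ι₂ * lam) + (exp 1 * τ) ^ 3 * (ι₃ * lam ^ 2) +
      A' * (exp 1 * τ * Q') * ((exp 1 * τ * lam * Q') ^ 3 / (1 - exp 1 * τ * lam * Q'))) < 1)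
    (hstep : ∀ N : ℕ, 2 ≤ N → Φ * towerV D τ μ < 1 →
      db ≤ towerFO D σ ν p + ∑ n ∈ Icc 2 N, exp 1 * Φ ^ (n - 1) * ψ ^ p * towerSLip D τ ν μ n p +
        Ct * (ψ ^ p * exp 1 * towerV D τ μ * (Φ * towerV D τ μ) ^ N / (1 - Φ * towerV D τ μ)) + src) :
    db ≤ R * ((Aν + κ₁ * lam / Q' + κ₂ / Q' ^ 2 + κ₃ / Q' ^ 3) * lam ^ (p - 1) * (4 * Q') ^ p * (4 * σ * lam * Q' / (1 - 4 * σ * lam * Q')) +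
        exp 1 * ψ ^ p * (τ * (κ₁ * lam) + τ ^ 2 * (κ₂ * lam) + τ ^ 3 * (κ₃ * lam ^ 2) + Aν * (τ * Q') * ((τ * lam * Q') ^ 3 / (1 - τ * lam * Q'))) *
          ((2 * (Φ * (τ * (ι₁ * lam) + τ ^ 2 * (ι₂ * lam) + τ ^ 3 * (ι₃ * lam ^ 2) + A' * (τ * Q') * ((τ * lam * Q') ^ 3 / (1 - τ * lam * Q')))) -
              (Φ * (τ * (ι₁ * lam) + τ ^ 2 * (ι₂ * lam) + τ ^ 3 * (ι₃ * lam ^ 2) + A' * (τ * Q') * ((τ * lam * Q') ^ 3 / (1 - τ * lam * Q')))) ^ 2) /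
            (1 - Φ * (τ * (ι₁ * lam) + τ ^ 2 * (ι₂ * lam) + τ ^ 3 * (ι₃ * lam ^ 2) + A' * (τ * Q') * ((τ * lam * Q') ^ 3 / (1 - τ * lam * Q')))) ^ 2)) + src := by
  set A'' := Aν + κ₁ * lam / Q' + κ₂ / Q' ^ 2 + κ₃ / Q' ^ 3 with hA''
  set V₁ := τ * (ι₁ * lam) + τ ^ 2 * (ι₂ * lam) + τ ^ 3 * (ι₃ * lam ^ 2) + A' * (τ * Q') * ((τ * lam * Q') ^ 3 / (1 - τ * lam * Q')) with hV₁
  have hA''0 : 0 ≤ A'' := by positivity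
  -- the one-piece envelope of the budgeted four-piece profile
  have h1d : 0 ≤ κ₁ * lam / Q' := by positivity
  have h2d : 0 ≤ κ₂ / Q' ^ 2 := by positivity
  have h3d : 0 ≤ κ₃ / Q' ^ 3 := by positivity
  have ha1 : κ₁ * lam / Q' ≤ A'' := by rw [hA'']; linarith
  have ha2 : κ₂ / Q' ^ 2 ≤ A'' := by rw [hA'']; linarith
  have ha3 : κ₃ / Q' ^ 3 ≤ A'' := by rw [hA'']; linarith
  have ha4 : Aν ≤ A'' := by rw [hA'']; linarith
  have hQ0 : Q' ≠ 0 := hQ'.ne'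
  have hνone : ∀ m, 1 ≤ m → m ≤ D → ν m ≤ (R * A'') * lam ^ (m - 1) * Q' ^ m := by
    intro m hm hmD
    rcases Nat.lt_or_ge m 4 with hlt | hge
    · interval_cases m
      · calc ν 1 ≤ R * (κ₁ * lam) := hν₁
          _ = (R * Q') * (κ₁ * lam / Q') := by field_simp
          _ ≤ (R * Q') * A'' := mul_le_mul_of_nonneg_left ha1 (by positivity)
          _ = (R * A'') * lam ^ (1 - 1) * Q' ^ 1 := by simp; ring
      · calc ν 2 ≤ R * (κ₂ * lam) := hν₂
          _ = (R * lam * Q' ^ 2) * (κ₂ / Q' ^ 2) := by field_simp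
          _ ≤ (R * lam * Q' ^ 2) * A'' := mul_le_mul_of_nonneg_left ha2 (by positivity)
          _ = (R * A'') * lam ^ (2 - 1) * Q' ^ 2 := by simp; ring
      · calc ν 3 ≤ R * (κ₃ * lam ^ 2) := hν₃
          _ = (R * lam ^ 2 * Q' ^ 3) * (κ₃ / Q' ^ 3) := by field_simp
          _ ≤ (R * lam ^ 2 * Q' ^ 3) * A'' := mul_le_mul_of_nonneg_left ha3 (by positivity)
          _ = (R * A'') * lam ^ (3 - 1) * Q' ^ 3 := by simp; ring
    · calc ν m ≤ R * (Aν * lam ^ (m - 1) * Q' ^ m) := hνprof m hge hmD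
        _ = (R * lam ^ (m - 1) * Q' ^ m) * Aν := by ring
        _ ≤ (R * lam ^ (m - 1) * Q' ^ m) * A'' := mul_le_mul_of_nonneg_left ha4 (by positivity)
        _ = (R * A'') * lam ^ (m - 1) * Q' ^ m := by ring
  have hFO := towerFO_le hσ (mul_nonneg hR hA''0) hlam.le hQ'.le hν0 hνone hx₁ hp (D := D)
  -- the `w = 1` graded data: `Σ τ^δ ν δ ≤ R·V₁`, `Σ τ^δ μ δ ≤ V₁`
  have hτe : 0 ≤ τ / exp 1 := by positivity
  have hx₃' : exp 1 * (τ / exp 1) * lam * Q' < 1 := by rwa [mul_div_cancel₀ _ (exp_pos 1).ne']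
  set V₁ν := τ * (κ₁ * lam) + τ ^ 2 * (κ₂ * lam) + τ ^ 3 * (κ₃ * lam ^ 2) + Aν * (τ * Q') * ((τ * lam * Q') ^ 3 / (1 - τ * lam * Q')) with hV₁ν
  have hprofd' : ∀ m, 4 ≤ m → m ≤ D → ν m ≤ (R * Aν) * lam ^ (m - 1) * Q' ^ m := fun m hm hmD =>
    (hνprof m hm hmD).trans_eq (by ring)
  have hdμ3' : ν 3 ≤ (R * κ₃) * lam ^ 2 := hν₃.trans_eq (by ring)
  have hdι₁' : ν 1 ≤ (R * κ₁) * lam := hν₁.trans_eq (by ring)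
  have hdι₂' : ν 2 ≤ (R * κ₂) * lam := hν₂.trans_eq (by ring)
  have heτ : exp 1 * (τ / exp 1) = τ := mul_div_cancel₀ _ (exp_pos 1).ne'
  have hGν : ∑ δ ∈ Icc 1 D, τ ^ δ * ν δ * (1 : ℝ) ^ (δ - 1) ≤ R * V₁ν := by
    rw [towerV_div_exp_eq]
    refine (towerV_le_fourPiece hτe hlam.le hQ'.le (mul_nonneg hR hAν) hν0 hdι₁' hdι₂' hdμ3' hprofd' hx₃').trans (le_of_eq ?_)
    rw [heτ, hV₁ν]; ring
  have hG : ∑ δ ∈ Icc 1 D, τ ^ δ * μ δ * (1 : ℝ) ^ (δ - 1) ≤ V₁ := by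
    rw [towerV_div_exp_eq]
    refine (towerV_le_fourPiece hτe hlam.le hQ'.le hA' hμ0 hι₁ hι₂ hι₃ hprofb hx₃').trans (le_of_eq ?_)
    rw [heτ, hV₁]
  have hVb := towerV_le_fourPiece hτ.le hlam.le hQ'.le hA' hμ0 hι₁ hι₂ hι₃ hprofb hx₃
  have hT2 := towerLipStep_le_of_chernoff (D := D) (w := 1) hΦ hψ hτ.le hν0 hμ0 le_rfl hCt hFO hGν hG hVb hy₁ hθ hstep
  refine hT2.trans (le_of_eq ?_)
  rw [one_pow, inv_one, hA'', hV₁ν]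
  ring

end Summit.HubbardSuperconductivity.HubbardSuperconductivity.Theorems.EngineV8

end
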